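import Summits.Ventures.CertifiedQuantumChemistry.Rows.CholeskyResidualBound
import Summits.Ventures.CertifiedQuantumChemistry.Rows.SectorBlockLowerBound
import Summits.Ventures.CertifiedQuantumChemistry.Rows.CIEnergySymmetric
import Mathlib.Algebra.Order.Chebyshev
import HarnessLib

/-!
# Ventures/CertifiedQuantumChemistry — Rows/GramResidualLowerBound.lean: the integer-Gram / Frobenius-residual LOWER bound on a
# sector block, fed to the kernel ROW BY ROW over the upper triangle (the device behind a kernel-proved `LowerRow` of a
# literal model)

HONEST FRAMING (verbatim): certified bounds for a stated model Hamiltonian in a stated basis; not a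
claim about the real molecule beyond that model.

var-2 (gen 15), zero compute, PROVED glue only (0 sorry, no definition, no claim node; nothing here asserts a bound about
any model). Companion of `Rows/CholeskyResidualBound.lean` (var-2 g7: `λ_min(H) ≥ μ − τ/c` from `c•(H − μ•1) = M Mᵀ + T`
with ROW/COLUMN sums of `|T|` at most `τ`) and of the typer's `Rows/SectorBlockLowerBound.lean` (a quadratic-form lower bound
on the occupation-basis block of `H_F` on a sector IS a `LowerRow`). This file replaces the `ℓ^∞` residual norm by the
FROBENIUS norm, which is what a kernel evaluation over the UPPER TRIANGLE of a symmetric residual delivers, and packages the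
whole chain in the shape the Lean kernel evaluates by `decide` on a literal model:

* `sq_dotProduct_mulVec_le` — `(v ⬝ᵥ T v)² ≤ (Σ_ij T_ij²) (v ⬝ᵥ v)²` (Cauchy–Schwarz on the index pairs);
  `abs_dotProduct_mulVec_le_of_sum_sq_le` — `Σ_ij T_ij² ≤ τ²`, `0 ≤ τ` ⇒ `|v ⬝ᵥ T v| ≤ τ (v ⬝ᵥ v)`.
* `le_dotProduct_mulVec_of_gram_frobenius` — `c•(H − μ•1) = M Mᵀ + T`, `Σ_ij T_ij² ≤ τ²`, `0 ≤ τ`, `0 < c` ⇒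
  `(μ − τ/c) (v ⬝ᵥ v) ≤ v ⬝ᵥ H v` (so `λ_min(H) ≥ μ − τ/c`; `M` rectangular, nothing about how it was found is used).
* `sum_fin_getD_mul_getD_eq_zipWith_sum` — the Gram entry of two ROW LISTS: with `M i l = (row i).getD l 0`,
  `(M Mᵀ)_ij = (zipWith (·*·) (row i) (row j)).sum` (the truncating `zipWith` IS the lower-triangular inner product; lists are
  what the kernel traverses in linear time, a `Fin`-indexed literal is not).
* `sum_sum_sq_le_of_upperRows` — for a symmetric `T` on `Fin n`: per-row bounds `T_ii² + 2 Σ_{j>i} T_ij² ≤ u_i` and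
  `Σ_i u_i ≤ τ²` give `Σ_ij T_ij² ≤ τ²` (each row one `decide +kernel`).
* `form_bound_of_guardedRows` — THE KERNEL ENTRY POINT over `ℚ` with conclusion over `ℝ`: a symmetric `H : Fin n → Fin n → ℚ`
  (in the instances `H i j = F.slaterCondon (d i) (d j)`), a decidable GUARD `g` with `¬ g i j → H i j = 0` (far excitation
  pairs are skipped before the matrix element), sign-encoded natural-number row lists `rows : Fin n → List ℕ` (entry `e`
  stands for the integer `(−1)^e ⌊e/2⌋`; natural-number literals elaborate on the fast path), a scale `κ > 0`, a shift `μ`,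
  row values `u` and `τ ≥ 0` with the decided hypotheses
  `hlen : ∀ i, (rows i).length ≤ n`, `hrow : ∀ i, T_ii² + 2 Σ_{j>i} T_ij² ≤ u_i` (with `T_ij = κ [g i j] H_ij − κ μ [i=j] − dot_ij`
  written out) and `hsum : Σ u_i ≤ τ²` ⇒ for every REAL `v`, `(μ − τ/κ) (v ⬝ᵥ v) ≤ v ⬝ᵥ (H v)`.
* `form_bound_of_sum_blocks` — a form on `α ⊕ β` that is block diagonal is bounded below by the smaller block bound;
  `lowerRow_of_two_blocks` — with the typer's bridge `lowerRow_of_sectorBlock_form`: an enumeration of the `(a, b)` sector in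
  two blocks `dA`, `dB` between which `F.slaterCondon` vanishes, and real form bounds `loA`, `loB` on the blocks, give
  `LowerRow F a b lo` for every `lo ≤ loA, loB`.

First use: `Certificates/H6Sto6gR1786KernelLower*.lean` (the `(3,3)` sector of `h6Sto6gR1786`, parity blocks `200 + 200`).
Reference for the residual argument: S. M. Rump, *Verification methods: rigorous results using floating-point arithmetic*,
Acta Numerica 19 (2010) §10.8 (a rounded Cholesky factor certifies positive definiteness when the residual is norm-bounded);
the Frobenius/Cauchy–Schwarz step is Horn–Johnson, *Matrix Analysis* (2013) §5.6 (`‖T‖₂ ≤ ‖T‖_F`).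
-/

namespace Summit.Ventures.CertifiedQuantumChemistry

open Matrix Finset

/-! ## The Frobenius residual bound (any linearly ordered field) -/

section Frobenius

variable {R : Type*} [Field R] [LinearOrder R] [IsStrictOrderedRing R]
variable {n m : Type*} [Fintype n] [Fintype m]

/-- Cauchy–Schwarz on the index pairs: `(v ⬝ᵥ T v)² ≤ (Σ_ij T_ij²) · (v ⬝ᵥ v)²`. -/
theorem sq_dotProduct_mulVec_le (T : Matrix n n R) (v : n → R) :
    (v ⬝ᵥ (T *ᵥ v)) ^ 2 ≤ (∑ i, ∑ j, T i j ^ 2) * (v ⬝ᵥ v) ^ 2 := by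
  classical
  have hform : v ⬝ᵥ (T *ᵥ v) = ∑ p : n × n, T p.1 p.2 * (v p.1 * v p.2) := by
    rw [dotProduct, ← Finset.univ_product_univ, Finset.sum_product]
    refine Finset.sum_congr rfl fun i _ => ?_
    rw [mulVec, dotProduct, Finset.mul_sum]
    exact Finset.sum_congr rfl fun j _ => by ring
  have hT : ∑ i, ∑ j, T i j ^ 2 = ∑ p : n × n, T p.1 p.2 ^ 2 := by
    rw [← Finset.univ_product_univ, Finset.sum_product]
  have hv : (v ⬝ᵥ v) ^ 2 = ∑ p : n × n, (v p.1 * v p.2) ^ 2 := by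
    rw [dotProduct, sq, Finset.sum_mul_sum, ← Finset.univ_product_univ, Finset.sum_product]
    exact Finset.sum_congr rfl fun i _ => Finset.sum_congr rfl fun j _ => by ring
  rw [hform, hT, hv]
  exact Finset.sum_mul_sq_le_sq_mul_sq _ _ _

/-- `Σ_ij T_ij² ≤ τ²` with `0 ≤ τ` gives `|v ⬝ᵥ T v| ≤ τ (v ⬝ᵥ v)` (`‖T‖₂ ≤ ‖T‖_F ≤ τ`). -/
theorem abs_dotProduct_mulVec_le_of_sum_sq_le (T : Matrix n n R) (τ : R) (hT : ∑ i, ∑ j, T i j ^ 2 ≤ τ ^ 2)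
    (hτ : 0 ≤ τ) (v : n → R) : |v ⬝ᵥ (T *ᵥ v)| ≤ τ * (v ⬝ᵥ v) := by
  have hvv : 0 ≤ v ⬝ᵥ v := Finset.sum_nonneg fun i _ => mul_self_nonneg _
  refine abs_le_of_sq_le_sq' ?_ (mul_nonneg hτ hvv) |>.elim (fun h1 h2 => abs_le.2 ⟨h1, h2⟩)
  calc (v ⬝ᵥ (T *ᵥ v)) ^ 2 ≤ (∑ i, ∑ j, T i j ^ 2) * (v ⬝ᵥ v) ^ 2 := sq_dotProduct_mulVec_le T v
    _ ≤ τ ^ 2 * (v ⬝ᵥ v) ^ 2 := mul_le_mul_of_nonneg_right hT (sq_nonneg _)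
    _ = (τ * (v ⬝ᵥ v)) ^ 2 := by ring

/-- **The Gram / Frobenius-residual lower bound.** If `c • (H − μ • 1) = M * Mᵀ + T` with `0 < c`, `Σ_ij T_ij² ≤ τ²` and
`0 ≤ τ`, then `(μ − τ / c) (v ⬝ᵥ v) ≤ v ⬝ᵥ (H v)` for every `v`; i.e. every eigenvalue of `H` is `≥ μ − τ / c`. -/
theorem le_dotProduct_mulVec_of_gram_frobenius [DecidableEq n] (H T : Matrix n n R) (M : Matrix n m R) (c μ τ : R)
    (hc : 0 < c) (hfac : c • (H - μ • (1 : Matrix n n R)) = M * Mᵀ + T) (hT : ∑ i, ∑ j, T i j ^ 2 ≤ τ ^ 2)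
    (hτ : 0 ≤ τ) (v : n → R) : (μ - τ / c) * (v ⬝ᵥ v) ≤ v ⬝ᵥ (H *ᵥ v) := by
  have hlhs : v ⬝ᵥ ((c • (H - μ • (1 : Matrix n n R))) *ᵥ v) = c * (v ⬝ᵥ (H *ᵥ v)) - c * μ * (v ⬝ᵥ v) := by
    rw [smul_mulVec, dotProduct_smul, sub_mulVec, smul_mulVec, one_mulVec, dotProduct_sub,
      dotProduct_smul, smul_eq_mul, smul_eq_mul]
    ring
  have hrhs : v ⬝ᵥ ((M * Mᵀ + T) *ᵥ v) = v ⬝ᵥ ((M * Mᵀ) *ᵥ v) + v ⬝ᵥ (T *ᵥ v) := by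
    rw [add_mulVec, dotProduct_add]
  have hgram := dotProduct_gram_mulVec_nonneg M v
  have hTv := (abs_le.mp (abs_dotProduct_mulVec_le_of_sum_sq_le T τ hT hτ v)).1
  have key : c * (v ⬝ᵥ (H *ᵥ v)) - c * μ * (v ⬝ᵥ v) ≥ -(τ * (v ⬝ᵥ v)) := by
    rw [← hlhs, hfac, hrhs]; linarith
  have hvv : 0 ≤ v ⬝ᵥ v := Finset.sum_nonneg fun i _ => mul_self_nonneg _
  rw [sub_mul, div_mul_eq_mul_div, sub_le_iff_le_add]
  have : τ * (v ⬝ᵥ v) / c ≥ μ * (v ⬝ᵥ v) - v ⬝ᵥ (H *ᵥ v) := by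
    rw [ge_iff_le, le_div_iff₀ hc]
    nlinarith
  linarith

omit [LinearOrder R] [IsStrictOrderedRing R] in
/-- A symmetric square-sum over `Fin n × Fin n` is its diagonal plus twice its strict upper triangle. -/
theorem sum_sum_sq_eq_diag_add_two_mul_upper {k : ℕ} (T : Fin k → Fin k → R) (hsym : ∀ i j, T i j = T j i) :
    ∑ i, ∑ j, T i j ^ 2 = ∑ i, (T i i ^ 2 + 2 * ∑ j, if i < j then T i j ^ 2 else 0) := by
  have htri : ∀ i j, T i j ^ 2 =
      (if i < j then T i j ^ 2 else 0) + ((if j < i then T i j ^ 2 else 0) + (if j = i then T i j ^ 2 else 0)) := by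
    intro i j
    rcases lt_trichotomy i j with h | h | h
    · rw [if_pos h, if_neg (lt_asymm h), if_neg (ne_of_gt h), add_zero, add_zero]
    · subst h
      rw [if_neg (lt_irrefl _), if_pos rfl, zero_add, zero_add]
    · rw [if_neg (lt_asymm h), if_pos h, if_neg (ne_of_lt h), zero_add, add_zero]
  have hlow : ∑ i, ∑ j, (if j < i then T i j ^ 2 else 0) = ∑ i, ∑ j, (if i < j then T i j ^ 2 else (0 : R)) := by
    rw [Finset.sum_comm]
    refine Finset.sum_congr rfl fun i _ => Finset.sum_congr rfl fun j _ => ?_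
    split_ifs with h
    · rw [hsym j i]
    · rfl
  have hdiag : ∀ i, ∑ j, (if j = i then T i j ^ 2 else 0) = T i i ^ 2 := fun i => by
    rw [Finset.sum_ite_eq' Finset.univ i (fun j => T i j ^ 2), if_pos (Finset.mem_univ i)]
  calc ∑ i, ∑ j, T i j ^ 2
      = ∑ i, ∑ j, ((if i < j then T i j ^ 2 else 0) +
          ((if j < i then T i j ^ 2 else 0) + (if j = i then T i j ^ 2 else 0))) :=
        Finset.sum_congr rfl fun i _ => Finset.sum_congr rfl fun j _ => htri i j
    _ = ∑ i, ∑ j, (if i < j then T i j ^ 2 else 0) +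
          (∑ i, ∑ j, (if j < i then T i j ^ 2 else 0) + ∑ i, ∑ j, (if j = i then T i j ^ 2 else 0)) := by
        simp only [Finset.sum_add_distrib]
    _ = ∑ i, (T i i ^ 2 + 2 * ∑ j, if i < j then T i j ^ 2 else 0) := by
        rw [hlow, Finset.sum_congr rfl fun i _ => hdiag i, Finset.sum_add_distrib, ← Finset.mul_sum]
        ring

/-- **Row feed.** For a symmetric `T` on `Fin n`: per-row bounds `T_ii² + 2 Σ_{j>i} T_ij² ≤ u_i` and `Σ_i u_i ≤ τ²` give
`Σ_ij T_ij² ≤ τ²` (each row is one kernel job; only the upper triangle is evaluated). -/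
theorem sum_sum_sq_le_of_upperRows {k : ℕ} (T : Fin k → Fin k → R) (hsym : ∀ i j, T i j = T j i) (u : Fin k → R)
    (τ2 : R) (hrow : ∀ i, T i i ^ 2 + 2 * (∑ j, if i < j then T i j ^ 2 else 0) ≤ u i) (hsum : ∑ i, u i ≤ τ2) :
    ∑ i, ∑ j, T i j ^ 2 ≤ τ2 := by
  rw [sum_sum_sq_eq_diag_add_two_mul_upper T hsym]
  exact (Finset.sum_le_sum fun i _ => hrow i).trans hsum

end Frobenius

/-! ## Gram entries of row lists -/

section Lists

variable {R : Type*} [CommRing R]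

/-- The Gram entry of two row lists: with out-of-range entries read as `0`,
`Σ_{l < m} a[l] · b[l] = (zipWith (·*·) a b).sum` whenever both lists have length `≤ m` (the truncating `zipWith` is the
inner product of zero-padded rows). -/
theorem sum_fin_getD_mul_getD_eq_zipWith_sum (a b : List R) {m : ℕ} (ha : a.length ≤ m) (hb : b.length ≤ m) :
    ∑ l : Fin m, a.getD l 0 * b.getD l 0 = (List.zipWith (· * ·) a b).sum := by
  induction a generalizing b m with
  | nil => simp
  | cons x xs ih =>
    cases b with
    | nil => simp
    | cons y ys =>
      cases m with
      | zero => simp at ha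
      | succ m =>
        rw [Fin.sum_univ_succ]
        simp only [List.length_cons, Nat.add_le_add_iff_right] at ha hb
        simp only [Fin.val_zero, List.getD_cons_zero, Fin.val_succ, List.getD_cons_succ, List.zipWith_cons_cons,
          List.sum_cons]
        rw [ih ys ha hb]

end Lists

/-! ## The kernel entry point: `ℚ` data, guarded matrix elements, sign-encoded row lists, conclusion over `ℝ` -/

section Entry

variable {k : ℕ}

/-- Decoding of a sign-encoded natural number: `e ↦ (−1)^e ⌊e/2⌋` (so `2m ↦ m`, `2m+1 ↦ −m`). Written out where used; this
lemma only records that the decoded row list has the length of the encoded one. -/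
theorem length_map_decode (r : List ℕ) :
    (r.map fun e : ℕ => if e % 2 = 0 then ((e / 2 : ℕ) : ℤ) else -((e / 2 : ℕ) : ℤ)).length = r.length :=
  List.length_map _

/-- **KERNEL ENTRY POINT (one block).** `H : Fin k → Fin k → ℚ` symmetric, `g` a decidable guard with `¬ g i j → H i j = 0`,
`rows : Fin k → List ℕ` sign-encoded integer rows of a factor (row `i` of length `≤ k`; entry `e` decodes to `(−1)^e ⌊e/2⌋`),
`0 < κ`, `0 ≤ τ`. If for every row `i`
`(κ (H i i − μ) − dot_ii)² + 2 Σ_{j>i} (κ [g i j] H i j − dot_ij)² ≤ u_i` (with `dot_ij` the truncating `zipWith` inner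
product of the decoded rows) and `Σ_i u_i ≤ τ²`, then the REAL quadratic form of `H` is bounded below:
`(μ − τ/κ) (v ⬝ᵥ v) ≤ v ⬝ᵥ (H v)` for every `v : Fin k → ℝ`. All hypotheses are decidable statements over `ℚ`. -/
theorem form_bound_of_guardedRows (H : Fin k → Fin k → ℚ) (hsym : ∀ i j, H i j = H j i)
    (g : Fin k → Fin k → Prop) [DecidableRel g] (hg : ∀ i j, ¬ g i j → H i j = 0)
    (rows : Fin k → List ℕ) (hlen : ∀ i, (rows i).length ≤ k) (κ μ τ : ℚ) (hκ : 0 < κ) (hτ : 0 ≤ τ) (u : Fin k → ℚ)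
    (hrow : ∀ i,
      (κ * (H i i - μ) - ((List.zipWith (· * ·)
          ((rows i).map fun e : ℕ => if e % 2 = 0 then ((e / 2 : ℕ) : ℤ) else -((e / 2 : ℕ) : ℤ))
          ((rows i).map fun e : ℕ => if e % 2 = 0 then ((e / 2 : ℕ) : ℤ) else -((e / 2 : ℕ) : ℤ))).sum : ℤ)) ^ 2 +
      2 * (∑ j, if i < j then
        (κ * (if g i j then H i j else 0) - ((List.zipWith (· * ·)
          ((rows i).map fun e : ℕ => if e % 2 = 0 then ((e / 2 : ℕ) : ℤ) else -((e / 2 : ℕ) : ℤ))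
          ((rows j).map fun e : ℕ => if e % 2 = 0 then ((e / 2 : ℕ) : ℤ) else -((e / 2 : ℕ) : ℤ))).sum : ℤ)) ^ 2
        else 0) ≤ u i)
    (hsum : ∑ i, u i ≤ τ ^ 2) (v : Fin k → ℝ) :
    (((μ - τ / κ : ℚ)) : ℝ) * (v ⬝ᵥ v) ≤ v ⬝ᵥ ((Matrix.of fun i j => (H i j : ℝ)) *ᵥ v) := by
  classical
  -- the decoded integer rows and the factor matrix over ℚ
  set dec : ℕ → ℤ := fun e => if e % 2 = 0 then ((e / 2 : ℕ) : ℤ) else -((e / 2 : ℕ) : ℤ) with hdec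
  set Z : Fin k → List ℤ := fun i => (rows i).map dec with hZ
  have hZlen : ∀ i, (Z i).length ≤ k := fun i => by rw [hZ, List.length_map]; exact hlen i
  let M : Matrix (Fin k) (Fin k) ℚ := Matrix.of fun i l => (((Z i).getD l 0 : ℤ) : ℚ)
  have hMM : ∀ i j, (M * Mᵀ) i j = (((List.zipWith (· * ·) (Z i) (Z j)).sum : ℤ) : ℚ) := by
    intro i j
    rw [Matrix.mul_apply]
    simp only [M, Matrix.transpose_apply, Matrix.of_apply]
    rw [← sum_fin_getD_mul_getD_eq_zipWith_sum (Z i) (Z j) (hZlen i) (hZlen j)]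
    push_cast
    rfl
  -- the exact rational residual
  let Hq : Matrix (Fin k) (Fin k) ℚ := Matrix.of fun i j => H i j
  let T : Matrix (Fin k) (Fin k) ℚ := κ • (Hq - μ • (1 : Matrix (Fin k) (Fin k) ℚ)) - M * Mᵀ
  have hfac : κ • (Hq - μ • (1 : Matrix (Fin k) (Fin k) ℚ)) = M * Mᵀ + T := by
    simp only [T]; abel
  have hTapply : ∀ i j, T i j = κ * (H i j - if i = j then μ else 0) -
      (((List.zipWith (· * ·) (Z i) (Z j)).sum : ℤ) : ℚ) := by
    intro i j
    simp only [T, Matrix.sub_apply, Matrix.smul_apply, Matrix.one_apply, smul_eq_mul, hMM, Hq, Matrix.of_apply]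
    split_ifs <;> ring
  have hzipsym : ∀ i j, (List.zipWith (· * ·) (Z i) (Z j)).sum = (List.zipWith (· * ·) (Z j) (Z i)).sum := by
    intro i j
    have h1 := hMM i j
    have h2 := hMM j i
    have hs : (M * Mᵀ) i j = (M * Mᵀ) j i := by
      rw [Matrix.mul_apply, Matrix.mul_apply]
      exact Finset.sum_congr rfl fun l _ => by rw [Matrix.transpose_apply, Matrix.transpose_apply, mul_comm]
    rw [h1, h2] at hs
    exact_mod_cast hs
  have hTsym : ∀ i j, T i j = T j i := by
    intro i j
    rw [hTapply, hTapply, hsym i j, hzipsym i j]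
    by_cases h : i = j
    · subst h; rfl
    · rw [if_neg h, if_neg (Ne.symm h)]
  -- the row feed gives the Frobenius bound over ℚ
  have hTrow : ∀ i, T i i ^ 2 + 2 * (∑ j, if i < j then T i j ^ 2 else 0) ≤ u i := by
    intro i
    have h := hrow i
    have hii : T i i = κ * (H i i - μ) - (((List.zipWith (· * ·) (Z i) (Z i)).sum : ℤ) : ℚ) := by
      rw [hTapply, if_pos rfl]
    have hij : ∀ j, i < j → T i j = κ * (if g i j then H i j else 0) -
        (((List.zipWith (· * ·) (Z i) (Z j)).sum : ℤ) : ℚ) := by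
      intro j hlt
      rw [hTapply, if_neg (ne_of_lt hlt)]
      by_cases hgij : g i j
      · rw [if_pos hgij, sub_zero]
      · rw [if_neg hgij, hg i j hgij, sub_zero]
    rw [hii]
    have hs : (∑ j, if i < j then T i j ^ 2 else (0 : ℚ)) =
        ∑ j, if i < j then (κ * (if g i j then H i j else 0) -
          (((List.zipWith (· * ·) (Z i) (Z j)).sum : ℤ) : ℚ)) ^ 2 else 0 := by
      refine Finset.sum_congr rfl fun j _ => ?_
      by_cases hlt : i < j
      · rw [if_pos hlt, if_pos hlt, hij j hlt]
      · rw [if_neg hlt, if_neg hlt]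
    rw [hs]
    exact h
  have hfrob : ∑ i, ∑ j, T i j ^ 2 ≤ τ ^ 2 := sum_sum_sq_le_of_upperRows T hTsym u (τ ^ 2) hTrow hsum
  -- cast everything to ℝ and apply the residual bound there
  let Hr : Matrix (Fin k) (Fin k) ℝ := Matrix.of fun i j => (H i j : ℝ)
  let Mr : Matrix (Fin k) (Fin k) ℝ := M.map ((↑) : ℚ → ℝ)
  let Tr : Matrix (Fin k) (Fin k) ℝ := T.map ((↑) : ℚ → ℝ)
  have hfacr : (κ : ℝ) • (Hr - (μ : ℝ) • (1 : Matrix (Fin k) (Fin k) ℝ)) = Mr * Mrᵀ + Tr := by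
    have hcast : (κ • (Hq - μ • (1 : Matrix (Fin k) (Fin k) ℚ))).map ((↑) : ℚ → ℝ) =
        (M * Mᵀ + T).map ((↑) : ℚ → ℝ) := by rw [hfac]
    have hl : (κ • (Hq - μ • (1 : Matrix (Fin k) (Fin k) ℚ))).map ((↑) : ℚ → ℝ) =
        (κ : ℝ) • (Hr - (μ : ℝ) • (1 : Matrix (Fin k) (Fin k) ℝ)) := by
      ext i j
      simp only [Matrix.map_apply, Matrix.smul_apply, Matrix.sub_apply, Matrix.one_apply, smul_eq_mul, Hq, Hr,
        Matrix.of_apply]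
      push_cast
      split_ifs <;> simp
    have hr : (M * Mᵀ + T).map ((↑) : ℚ → ℝ) = Mr * Mrᵀ + Tr := by
      ext i j
      simp only [Matrix.map_apply, Matrix.add_apply, Matrix.mul_apply, Matrix.transpose_apply, Mr, Tr,
        Rat.cast_add, Rat.cast_sum, Rat.cast_mul]
    rw [← hl, hcast, hr]
  have hTr : ∑ i, ∑ j, Tr i j ^ 2 ≤ (τ : ℝ) ^ 2 := by
    have : ((∑ i, ∑ j, T i j ^ 2 : ℚ) : ℝ) ≤ ((τ ^ 2 : ℚ) : ℝ) := by exact_mod_cast hfrob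
    simpa [Tr, Matrix.map_apply, Rat.cast_sum, Rat.cast_pow] using this
  have key := le_dotProduct_mulVec_of_gram_frobenius Hr Tr Mr (κ : ℝ) (μ : ℝ) (τ : ℝ) (by exact_mod_cast hκ) hfacr hTr
    (by exact_mod_cast hτ) v
  have hcoef : (((μ - τ / κ : ℚ)) : ℝ) = (μ : ℝ) - (τ : ℝ) / (κ : ℝ) := by push_cast; rfl
  rw [hcoef]
  exact key

end Entry

/-! ## Two blocks -/

section Blocks

variable {R : Type*} [Field R] [LinearOrder R] [IsStrictOrderedRing R]
variable {α β : Type*} [Fintype α] [Fintype β]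

/-- **Block-diagonal forms on a sum type.** If `H (inl a) (inr b) = 0 = H (inr b) (inl a)` and the two diagonal blocks are
bounded below by `lo`, so is the whole form. -/
theorem form_bound_of_sum_blocks (H : Matrix (α ⊕ β) (α ⊕ β) R) (lo : R)
    (hAB : ∀ a b, H (Sum.inl a) (Sum.inr b) = 0) (hBA : ∀ b a, H (Sum.inr b) (Sum.inl a) = 0)
    (hA : ∀ x : α → R, lo * (x ⬝ᵥ x) ≤ x ⬝ᵥ ((H.submatrix Sum.inl Sum.inl) *ᵥ x))
    (hB : ∀ y : β → R, lo * (y ⬝ᵥ y) ≤ y ⬝ᵥ ((H.submatrix Sum.inr Sum.inr) *ᵥ y))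
    (v : α ⊕ β → R) : lo * (v ⬝ᵥ v) ≤ v ⬝ᵥ (H *ᵥ v) := by
  have hvv : v ⬝ᵥ v = (fun a => v (Sum.inl a)) ⬝ᵥ (fun a => v (Sum.inl a)) +
      (fun b => v (Sum.inr b)) ⬝ᵥ (fun b => v (Sum.inr b)) := by
    simp only [dotProduct, Fintype.sum_sum_type]
  have hform : v ⬝ᵥ (H *ᵥ v) =
      (fun a => v (Sum.inl a)) ⬝ᵥ ((H.submatrix Sum.inl Sum.inl) *ᵥ fun a => v (Sum.inl a)) +
      (fun b => v (Sum.inr b)) ⬝ᵥ ((H.submatrix Sum.inr Sum.inr) *ᵥ fun b => v (Sum.inr b)) := by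
    simp only [dotProduct, mulVec, Matrix.submatrix_apply, Fintype.sum_sum_type, hAB, hBA, zero_mul, add_zero,
      zero_add, Finset.sum_const_zero]
  rw [hvv, hform, mul_add]
  exact add_le_add (hA _) (hB _)

end Blocks

section TwoBlocks

open Literature.MathematicalPhysics.QuantumLattice Literature.MathematicalPhysics.QuantumChemistry

variable {k : ℕ}

/-- **`LowerRow` from two kernel blocks.** `F` symmetric, `a, b ≤ k`; `dA : α → …`, `dB : β → …` together enumerate the
`(a, b)` sector (jointly injective, covering), `F.slaterCondon` vanishes between the two families, and the real forms of the
two blocks are bounded below by `loA`, `loB`. Then `LowerRow F a b lo` for every `lo ≤ loA, loB`. -/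
theorem lowerRow_of_two_blocks {F : Model k} (hF : F.IsSymmetric) {a b : ℕ} (ha : a ≤ k) (hb : b ≤ k)
    {α β : Type*} [Fintype α] [Fintype β] (dA : α → Finset (Orb (Fin k))) (dB : β → Finset (Orb (Fin k)))
    (hinj : Function.Injective (Sum.elim dA dB))
    (hsurj : ∀ s : Finset (Orb (Fin k)), (upPart s).card = a ∧ (downPart s).card = b → ∃ i, Sum.elim dA dB i = s)
    (hcross : ∀ x y, F.slaterCondon (dA x) (dB y) = 0)
    {loA loB lo : ℚ} (hloA : lo ≤ loA) (hloB : lo ≤ loB)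
    (hA : ∀ v : α → ℝ, (loA : ℝ) * (v ⬝ᵥ v) ≤ v ⬝ᵥ ((Matrix.of fun i j => (F.slaterCondon (dA i) (dA j) : ℝ)) *ᵥ v))
    (hB : ∀ v : β → ℝ, (loB : ℝ) * (v ⬝ᵥ v) ≤ v ⬝ᵥ ((Matrix.of fun i j => (F.slaterCondon (dB i) (dB j) : ℝ)) *ᵥ v)) :
    LowerRow F a b lo := by
  refine lowerRow_of_sectorBlock_form hF ha hb (Sum.elim dA dB) hinj hsurj fun w => ?_
  refine form_bound_of_sum_blocks _ (lo : ℝ) (fun x y => ?_) (fun y x => ?_) (fun x => ?_) (fun y => ?_) w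
  · rw [Matrix.of_apply, Sum.elim_inl, Sum.elim_inr, hcross x y, Rat.cast_zero]
  · rw [Matrix.of_apply, Sum.elim_inl, Sum.elim_inr, Model.slaterCondon_comm hF, hcross x y, Rat.cast_zero]
  · have hvv : 0 ≤ x ⬝ᵥ x := Finset.sum_nonneg fun i _ => mul_self_nonneg _
    have h1 : (lo : ℝ) * (x ⬝ᵥ x) ≤ (loA : ℝ) * (x ⬝ᵥ x) :=
      mul_le_mul_of_nonneg_right (by exact_mod_cast hloA) hvv
    exact h1.trans (by simpa [Matrix.submatrix] using hA x)
  · have hvv : 0 ≤ y ⬝ᵥ y := Finset.sum_nonneg fun i _ => mul_self_nonneg _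
    have h1 : (lo : ℝ) * (y ⬝ᵥ y) ≤ (loB : ℝ) * (y ⬝ᵥ y) :=
      mul_le_mul_of_nonneg_right (by exact_mod_cast hloB) hvv
    exact h1.trans (by simpa [Matrix.submatrix] using hB y)

end TwoBlocks

end Summit.Ventures.CertifiedQuantumChemistry
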